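import Summits.NavierStokesRegularity.NavierStokesRegularity.Theses.SqueezeCycle
import Summits.NavierStokesRegularity.NavierStokesRegularity.Theorems.SqueezeCycleNoApexTypeIProfileEnvelopeTypeIBound
import Summits.NavierStokesRegularity.NavierStokesRegularity.Theorems.RellichScarScarRigidityApexMild
import Summits.NavierStokesRegularity.NavierStokesRegularity.Theorems.RellichScarScarRigidityApexRegularity
import Literature.Analysis.FluidPDE.LocalTypeICongr
import Literature.Analysis.FluidPDE.LocalTypeILiouville
import HarnessLib

/-!
# Route SqueezeCycle · item `NoApexTypeIProfile` (stmt-NavierStokesRegularity-11716):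
# `𝐈 < ∞` and the weak gradient are IDLE hypotheses — the item is KNSS (1.6) verbatim

Helper file (theorems only; no definitions, no named facts), `--supports` the item (part 3 of 3).

The item (SqueezeCycle rank-2 crux = RellichScar target, the two copies agree by `Iff.rfl`) reads:
no suitable weak solution `(u,p)` on the slab `ℝ³ × (−∞,0)` with a weak gradient `G`,
Albritton–Barker's `𝐈(ℝ³ × ℝ₋) = typeIBound (Iio 0 ×ˢ univ) u p G < ⊤` and the apex bound
`‖u(t,x)‖ ≤ C/(‖x‖ + √(−t))` is backward-singular at the origin.  **Main result**
(`noApexTypeIProfile_iff_knss`): it is EQUIVALENT to the same statement with the weak gradient and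
`𝐈 < ∞` deleted — i.e. to Koch–Nadirashvili–Seregin–Šverák's (1.6) "no Type-I blow-up profile" for
suitable weak solutions, with no local-energy bookkeeping at all.  (Contrast the RATE class, where
`𝐈 < ∞` is load-bearing: the parasitic flows, `Negative/FalseWithoutTypeIBound`.)

Proof of `→`.  A singular apex profile has `0 < C` (`pos_const_of_apexSingular`).  By KNSS 2009 §4
(Lemma 3.1: bounded weak solutions are mild modulo a parasitic drift, killed here by the spatial
decay; Prop. 4.1: smoothing) it is a.e. a Type-I ancient mild field `V` with the apex bound
(`exists_typeIAncientMild_repr_of_hasTypeIDecay` — the landed `stub_apexMildRepresentative` with its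
two unused hypotheses removed); `V` is classical for its Riesz pressure `Q` with the scale-invariant
package `‖∇V‖, |Q| ≤ L/(‖x‖+√(−t))²` (`stub_apexRegularity`, Seregin–Šverák 2009 §2), hence suitable
weak on the slab with weak gradient `∇V` (CKN 1982 §2) and — part 2 — `𝐈 < ∞`
(`typeIBound_slab_lt_top_of_envelopes`); the singular origin passes to `V` (essential suprema).
So `(V, Q, ∇V, C)` is a singular apex profile of the FULL class, excluded by the item.

## References

* G. Koch, N. Nadirashvili, G. Seregin, V. Šverák, *Liouville theorems for the Navier–Stokes
  equations and applications*, Acta Math. 203 (2009) = arXiv:0709.3599, (1.6), Lemma 3.1, §4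
  Prop. 4.1, proof of Thm 6.1. [KochNadirashviliSereginSverak2009, KNSS2009]
* D. Albritton, T. Barker, J. Math. Fluid Mech. 21 (2019) = arXiv:1811.00502, §1. [AlbrittonBarker2019]
* G. Seregin, V. Šverák, Comm. PDE 34 (2009) = arXiv:0804.1803, §2 p. 8. [SereginSverak2009]
* L. Caffarelli, R. Kohn, L. Nirenberg, Comm. Pure Appl. Math. 35 (1982), §2. [CaffarelliKohnNirenberg1982]
-/

noncomputable section

-- the sub-problem namespace repeats the summit name (D-0017 layout `Summit.<S>.<P>.Theorems`)
set_option linter.dupNamespace false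

namespace Summit.NavierStokesRegularity.NavierStokesRegularity.Theorems.NoApexKNSS

open Set Filter Function MeasureTheory Metric TopologicalSpace
open scoped Topology ENNReal NNReal InnerProductSpace RealInnerProductSpace
open Literature.Analysis.FluidPDE
open Literature.Analysis
open Summit.NavierStokesRegularity.NavierStokesRegularity.Theses
open Summit.NavierStokesRegularity.NavierStokesRegularity.Theorems.RellichScarScarRigidity
  (exists_smooth_oseenMild_Ioo stub_apexRegularity)
open Summit.NavierStokesRegularity.NavierStokesRegularity.Theorems.ScarRigidity.Negative
  (pos_const_of_apexSingular)
open Summit.NavierStokesRegularity.NavierStokesRegularity.Theorems.NoApexEnvelope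
  (typeIBound_slab_lt_top_of_envelopes)
open Literature.Analysis.FluidPDE.ParabolicBump (continuous_frobeniusNormSq₃)


/-! ### Apex profiles are Type-I ancient mild fields — without `𝐈 < ∞` -/

/-- **Type-I ancient mild representative of an apex profile, no `𝐈`-hypothesis.**  A suitable weak
solution `u` on the slab `(-∞,0) × ℝ³` with the apex bound `‖u(t,x)‖ ≤ C/(‖x‖ + √(-t))` is a.e.
equal on the slab to a field `V` in the class `IsTypeIAncientMild C V` obeying the apex bound
pointwise.  This is `stub_apexMildRepresentative` (crux 11717, p73895) with its two UNUSED
hypotheses — the weak gradient and Albritton–Barker's `𝐈 < ∞` — removed from the signature (same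
proof: smooth Oseen-mild representatives on the exhausting windows `(-(n+2), -1/(n+2))`, where the
spatial decay kills the parasitic drift, patched along overlaps).
[cite: KochNadirashviliSereginSverak2009, §4 Prop. 4.1, Lemma 3.1 and proof of Thm 6.1 (arXiv:0709.3599 pp. 7–8, 12)] -/
theorem exists_typeIAncientMild_repr_of_hasTypeIDecay {u : ℝ → (EuclideanSpace ℝ (Fin 3)) → (EuclideanSpace ℝ (Fin 3))} {p : ℝ → (EuclideanSpace ℝ (Fin 3)) → ℝ}
    {C : ℝ} (hsw : IsSuitableWeakSolutionOn (slab (EuclideanSpace ℝ (Fin 3)) (Iio (0 : ℝ)) isOpen_Iio) 1 0 u p) (hd : HasTypeIDecay C u) :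
    ∃ V : ℝ → (EuclideanSpace ℝ (Fin 3)) → (EuclideanSpace ℝ (Fin 3)),
      uncurry V =ᵐ[volume.restrict (Iio (0 : ℝ) ×ˢ (univ : Set (EuclideanSpace ℝ (Fin 3))))] uncurry u ∧
      IsTypeIAncientMild C V ∧ HasTypeIDecay C V := by
  -- adapted from `stub_apexMildRepresentative` (Theorems/RellichScarScarRigidityApexMild.lean)
  have hC : 0 ≤ C := nonneg_of_hasTypeIDecay hd
  -- the exhausting windows `(-(n+2), -1/(n+2))`
  set aW : ℕ → ℝ := fun n => -((n : ℝ) + 2) with haW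
  set bW : ℕ → ℝ := fun n => -(1 / ((n : ℝ) + 2)) with hbW
  have hpos : ∀ n : ℕ, (0 : ℝ) < (n : ℝ) + 2 := fun n => by positivity
  have hb : ∀ n, bW n < 0 := fun n => by
    simp only [hbW, neg_lt_zero]
    exact one_div_pos.2 (hpos n)
  have hab : ∀ n, aW n < bW n := fun n => by
    have h1 : 1 / ((n : ℝ) + 2) ≤ 1 := by
      rw [div_le_one (hpos n)]
      linarith
    simp only [haW, hbW]
    linarith
  choose Vn hsm hdiv hmild hae using fun n => exists_smooth_oseenMild_Ioo hsw hd (hab n) (hb n)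
  -- every `t < 0` lies in the window of index `ι t`
  set ι : ℝ → ℕ := fun t => ⌈max (-t) (1 / (-t))⌉₊ with hι
  have hmem : ∀ t < 0, t ∈ Ioo (aW (ι t)) (bW (ι t)) := by
    intro t ht
    have h1 : max (-t) (1 / (-t)) ≤ (ι t : ℝ) := Nat.le_ceil _
    have hnt : -t ≤ (ι t : ℝ) := (le_max_left _ _).trans h1
    have hit : 1 / (-t) ≤ (ι t : ℝ) := (le_max_right _ _).trans h1
    refine ⟨by simp only [haW]; linarith, ?_⟩
    have h2 : 1 / (-t) < (ι t : ℝ) + 2 := by linarith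
    have h3 : 1 / ((ι t : ℝ) + 2) < -t := by
      rw [div_lt_iff₀ (hpos _)]
      have := (div_lt_iff₀ (neg_pos.2 ht)).1 h2
      linarith
    simp only [hbW]
    linarith
  -- the windows increase
  have hsubW : ∀ {m n : ℕ}, m ≤ n → Ioo (aW m) (bW m) ⊆ Ioo (aW n) (bW n) := fun {m n} h => by
    have hc := (Nat.cast_le (α := ℝ)).2 h
    refine Ioo_subset_Ioo (by simp only [haW]; linarith) ?_
    simp only [hbW, neg_le_neg_iff]
    exact one_div_le_one_div_of_le (hpos m) (by linarith)
  -- two window fields agree on the overlap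
  have hcons : ∀ m n, ∀ t ∈ Ioo (aW m) (bW m), t ∈ Ioo (aW n) (bW n) → ∀ x, Vn m t x = Vn n t x := by
    suffices H : ∀ m n, m ≤ n → ∀ t ∈ Ioo (aW m) (bW m), ∀ x, Vn m t x = Vn n t x by
      intro m n t htm htn x
      rcases le_total m n with h | h
      · exact H m n h t htm x
      · exact (H n m h t htn x).symm
    intro m n hmn t ht x
    have hO : IsOpen (Ioo (aW m) (bW m) ×ˢ (univ : Set (EuclideanSpace ℝ (Fin 3)))) := isOpen_Ioo.prod isOpen_univ
    have hcm : ContinuousOn (uncurry (Vn m)) (Ioo (aW m) (bW m) ×ˢ univ) := (hsm m).continuousOn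
    have hcn : ContinuousOn (uncurry (Vn n)) (Ioo (aW m) (bW m) ×ˢ univ) :=
      (hsm n).continuousOn.mono (prod_mono (hsubW hmn) Subset.rfl)
    have haen : uncurry (Vn n) =ᵐ[volume.restrict (Ioo (aW m) (bW m) ×ˢ (univ : Set (EuclideanSpace ℝ (Fin 3))))]
        uncurry u :=
      ae_restrict_of_ae_restrict_of_subset (prod_mono (hsubW hmn) Subset.rfl) (hae n)
    have haemn : uncurry (Vn m) =ᵐ[volume.restrict (Ioo (aW m) (bW m) ×ˢ (univ : Set (EuclideanSpace ℝ (Fin 3))))]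
        uncurry (Vn n) := (hae m).trans haen.symm
    exact Measure.eqOn_open_of_ae_eq haemn hO hcm hcn (mk_mem_prod ht (mem_univ x))
  -- the patched field
  set V : ℝ → (EuclideanSpace ℝ (Fin 3)) → (EuclideanSpace ℝ (Fin 3)) := fun t x => Vn (ι t) t x with hV
  have hVeq : ∀ n, ∀ t ∈ Ioo (aW n) (bW n), V t = Vn n t := fun n t ht => by
    funext x
    exact hcons (ι t) n t (hmem t (ht.2.trans (hb n))) ht x
  -- `V = u` a.e. on the slab
  have haeV : uncurry V =ᵐ[volume.restrict (Iio (0 : ℝ) ×ˢ (univ : Set (EuclideanSpace ℝ (Fin 3))))] uncurry u := by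
    have hU : Iio (0 : ℝ) ×ˢ (univ : Set (EuclideanSpace ℝ (Fin 3))) = ⋃ n : ℕ, Ioo (aW n) (bW n) ×ˢ (univ : Set (EuclideanSpace ℝ (Fin 3))) := by
      ext ⟨t, x⟩
      simp only [mem_prod, mem_Iio, mem_univ, and_true, mem_iUnion]
      exact ⟨fun ht => ⟨ι t, hmem t ht⟩, fun ⟨n, hn⟩ => hn.2.trans (hb n)⟩
    rw [hU]
    refine (ae_restrict_iUnion_iff _ _).2 fun n => ?_
    filter_upwards [hae n, ae_restrict_mem (measurableSet_Ioo.prod MeasurableSet.univ)] with q hq hqO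
    rw [← hq]
    show V q.1 q.2 = Vn n q.1 q.2
    rw [hVeq n q.1 hqO.1]
  -- the apex bound passes to the continuous representative
  have hdecV : HasTypeIDecay C V := by
    intro t ht x
    have htW := hmem t ht
    have hO : IsOpen (Ioo (aW (ι t)) (bW (ι t)) ×ˢ (univ : Set (EuclideanSpace ℝ (Fin 3)))) := isOpen_Ioo.prod isOpen_univ
    have hf : ContinuousOn (fun q : ℝ × (EuclideanSpace ℝ (Fin 3)) => ‖Vn (ι t) q.1 q.2‖) (Ioo (aW (ι t)) (bW (ι t)) ×ˢ univ) :=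
      (hsm (ι t)).continuousOn.norm
    have hg : ContinuousOn (fun q : ℝ × (EuclideanSpace ℝ (Fin 3)) => C / (‖q.2‖ + Real.sqrt (-q.1)))
        (Ioo (aW (ι t)) (bW (ι t)) ×ˢ univ) := by
      refine continuousOn_const.div (Continuous.continuousOn (by fun_prop)) fun q hq => ?_
      have : 0 < Real.sqrt (-q.1) := Real.sqrt_pos.2 (by linarith [hq.1.2, hb (ι t)])
      positivity
    have haemin : (fun q : ℝ × (EuclideanSpace ℝ (Fin 3)) => ‖Vn (ι t) q.1 q.2‖ ⊓ (C / (‖q.2‖ + Real.sqrt (-q.1)))) =ᵐ[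
        volume.restrict (Ioo (aW (ι t)) (bW (ι t)) ×ˢ (univ : Set (EuclideanSpace ℝ (Fin 3))))]
        fun q => ‖Vn (ι t) q.1 q.2‖ := by
      filter_upwards [hae (ι t), ae_restrict_mem (measurableSet_Ioo.prod MeasurableSet.univ)]
        with q hq hqO
      have hq' : Vn (ι t) q.1 q.2 = u q.1 q.2 := hq
      rw [hq']
      exact inf_eq_left.2 (hd q.1 (hqO.1.2.trans (hb (ι t))) q.2)
    have heq := Measure.eqOn_open_of_ae_eq haemin hO (hf.inf hg) hf (mk_mem_prod htW (mem_univ x))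
    have hVt : V t x = Vn (ι t) t x := rfl
    rw [hVt]
    exact inf_eq_left.1 heq
  -- joint smoothness (local), divergence, Oseen equation, rate
  have hcont : ContDiffOn ℝ (⊤ : ℕ∞) (uncurry V) (Iio 0 ×ˢ univ) := by
    refine contDiffOn_of_locally_contDiffOn ?_
    rintro ⟨t, x⟩ ⟨ht, -⟩
    have ht' : t < 0 := ht
    refine ⟨Ioo (aW (ι t)) (bW (ι t)) ×ˢ univ, isOpen_Ioo.prod isOpen_univ, ⟨hmem t ht', mem_univ _⟩,
      ?_⟩
    have hsmt : ContDiffOn ℝ (⊤ : ℕ∞) (uncurry (Vn (ι t))) (Ioo (aW (ι t)) (bW (ι t)) ×ˢ univ) :=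
      hsm (ι t)
    refine (hsmt.mono inter_subset_right).congr ?_
    rintro ⟨τ, y⟩ ⟨-, hτ, -⟩
    show V τ y = Vn (ι t) τ y
    rw [hVeq (ι t) τ hτ]
  have hmildV : ∀ s t : ℝ, s < t → t < 0 → ∀ x,
      V t x = heatFlow (V s) (t - s) x - oseenDuhamel 1 s V V t x := by
    intro s t hst ht x
    have hs : s < 0 := hst.trans ht
    have hsW : s ∈ Ioo (aW (max (ι s) (ι t))) (bW (max (ι s) (ι t))) :=
      hsubW (le_max_left _ _) (hmem s hs)
    have htW : t ∈ Ioo (aW (max (ι s) (ι t))) (bW (max (ι s) (ι t))) :=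
      hsubW (le_max_right _ _) (hmem t ht)
    rw [heatFlow_of_pos _ (sub_pos.2 hst), hVeq _ t htW, hVeq _ s hsW,
      hmild (max (ι s) (ι t)) s t hsW.1 hst htW.2 x]
    congr 1
    refine oseenDuhamel_congr_Ioo (fun τ hτ => ?_) (fun τ hτ => ?_) x <;>
      exact (hVeq _ τ ⟨hsW.1.trans hτ.1, hτ.2.trans htW.2⟩).symm
  refine ⟨V, haeV, ⟨hcont, fun t ht => ?_, hmildV, hdecV.hasTypeITimeDecay hC⟩, hdecV⟩
  rw [hVeq (ι t) t (hmem t ht)]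
  exact hdiv (ι t) t (hmem t ht)

/-! ### The representative carries a pressure with `𝐈 < ∞` -/

/-- **An apex-class Type-I ancient mild field is an Albritton–Barker slab profile with `𝐈 < ∞`.**
For `V` Type-I ancient mild with the apex bound (`0 < C`), the Riesz pressure `Q = RᵢRⱼ(VᵢVⱼ)` of
`stub_apexRegularity` makes `(V, Q)` classical on `(−∞,0)`, hence suitable weak on the slab with
weak gradient `∇V` (CKN 1982 §2), and the scale-invariant package `‖∇V‖, |Q| ≤ L/(‖x‖+√(−t))²`
feeds `typeIBound_slab_lt_top_of_envelopes`: `𝐈(ℝ³ × ℝ₋) < ∞`.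
[cite: AlbrittonBarker2019, §1] [cite: SereginSverak2009, §2 p. 8] -/
theorem exists_pressure_typeIBound_lt_top {V : ℝ → (EuclideanSpace ℝ (Fin 3)) → (EuclideanSpace ℝ (Fin 3))} {C : ℝ} (hC : 0 < C)
    (hV : IsTypeIAncientMild C V) (hdV : HasTypeIDecay C V) :
    ∃ Q : ℝ → (EuclideanSpace ℝ (Fin 3)) → ℝ, IsSuitableWeakSolutionOn (slab (EuclideanSpace ℝ (Fin 3)) (Iio (0 : ℝ)) isOpen_Iio) 1 0 V Q ∧
      HasWeakSpatialGradientOn (slab (EuclideanSpace ℝ (Fin 3)) (Iio (0 : ℝ)) isOpen_Iio) V (fun t x => fderiv ℝ (V t) x) ∧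
      typeIBound (Iio (0 : ℝ) ×ˢ univ) V Q (fun t x => fderiv ℝ (V t) x) < ⊤ := by
  obtain ⟨Q, hcl, hSIB⟩ := stub_apexRegularity V C hC hV hdV
  have hQ : (((slab (EuclideanSpace ℝ (Fin 3)) (Iio (0 : ℝ)) isOpen_Iio) : Opens (ℝ × (EuclideanSpace ℝ (Fin 3)))) : Set (ℝ × (EuclideanSpace ℝ (Fin 3)))) ⊆ Iio (0 : ℝ) ×ˢ univ := by rw [coe_slab]
  refine ⟨Q, ?_, ?_, ?_⟩
  · refine isSuitableWeakSolutionOn_of_contDiffOn isOpen_Iio hQ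
      (hcl.smooth_velocity.of_le (by norm_cast)) (hcl.smooth_pressure.of_le (by norm_cast))
      continuousOn_const (fun t ht x => ?_) hcl.divFree
    have hm := hcl.momentum t ht x
    rwa [timeDerivWithin_apply, derivWithin_of_isOpen isOpen_Iio ht, ← timeDeriv_apply] at hm
  · exact hasWeakSpatialGradientOn_of_contDiffOn isOpen_Iio hQ (hV.contDiffOn.of_le (by norm_cast))
  · -- envelopes at orders `0` (pressure) and `1` (velocity gradient), one constant
    obtain ⟨L₀, h0⟩ := hSIB 0
    obtain ⟨L₁, h1⟩ := hSIB 1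
    have hGenv : ∀ t < 0, ∀ x, ‖fderiv ℝ (V t) x‖ ≤ max L₀ L₁ / (‖x‖ + Real.sqrt (-t)) ^ 2 := by
      intro t ht x
      have h := (h1 t ht x).1
      rw [norm_iteratedFDeriv_one] at h
      have hw : 0 < (‖x‖ + Real.sqrt (-t)) ^ 2 := by
        have := Real.sqrt_pos.2 (neg_pos.2 ht); positivity
      exact h.trans (div_le_div_of_nonneg_right (le_max_right _ _) hw.le)
    have hQenv : ∀ t < 0, ∀ x, |Q t x| ≤ max L₀ L₁ / (‖x‖ + Real.sqrt (-t)) ^ 2 := by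
      intro t ht x
      have h := (h0 t ht x).2.1
      rw [norm_iteratedFDeriv_zero, Real.norm_eq_abs, add_zero] at h
      have hw : 0 < (‖x‖ + Real.sqrt (-t)) ^ 2 := by
        have := Real.sqrt_pos.2 (neg_pos.2 ht); positivity
      exact h.trans (div_le_div_of_nonneg_right (le_max_left _ _) hw.le)
    -- measurability (everything is continuous on the open slab)
    have hS : MeasurableSet (Iio (0 : ℝ) ×ˢ (univ : Set (EuclideanSpace ℝ (Fin 3)))) :=
      measurableSet_Iio.prod MeasurableSet.univ
    have hVm : AEMeasurable (uncurry V) (volume.restrict (Iio (0 : ℝ) ×ˢ (univ : Set (EuclideanSpace ℝ (Fin 3))))) :=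
      hV.continuousOn_uncurry.aemeasurable hS
    have hQm : AEStronglyMeasurable (uncurry Q) (volume.restrict (Iio (0 : ℝ) ×ˢ (univ : Set (EuclideanSpace ℝ (Fin 3))))) :=
      hcl.smooth_pressure.continuousOn.aestronglyMeasurable hS
    have hGc : ContinuousOn (fun q : ℝ × (EuclideanSpace ℝ (Fin 3)) => fderiv ℝ (V q.1) q.2) (Iio (0 : ℝ) ×ˢ univ) :=
      continuousOn_fderiv_slice_of_contDiffOn (hV.contDiffOn.of_le (by norm_cast))
        isOpen_Iio.uniqueDiffOn
    have hGm : AEMeasurable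
        (fun q : ℝ × (EuclideanSpace ℝ (Fin 3)) => ENNReal.ofReal (frobeniusNormSq (fderiv ℝ (V q.1) q.2)))
        (volume.restrict (Iio (0 : ℝ) ×ˢ (univ : Set (EuclideanSpace ℝ (Fin 3))))) :=
      (ENNReal.continuous_ofReal.comp_continuousOn
        (continuous_frobeniusNormSq₃.comp_continuousOn hGc)).aemeasurable hS
    exact typeIBound_slab_lt_top_of_envelopes hVm hQm hGm hdV hGenv hQenv

/-- **`𝐈 < ∞` is automatic in the apex class, up to the representative.**  Every suitable weak
solution on the slab with the apex bound (`0 < C`) is a.e. equal on the slab to an apex profile in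
the FULL Albritton–Barker class of the item: suitable weak for some pressure, weak gradient, `𝐈 < ∞`,
same apex constant. [cite: AlbrittonBarker2019, §1] -/
theorem exists_apexProfile_repr {u : ℝ → (EuclideanSpace ℝ (Fin 3)) → (EuclideanSpace ℝ (Fin 3))} {p : ℝ → (EuclideanSpace ℝ (Fin 3)) → ℝ} {C : ℝ}
    (hsw : IsSuitableWeakSolutionOn (slab (EuclideanSpace ℝ (Fin 3)) (Iio (0 : ℝ)) isOpen_Iio) 1 0 u p) (hd : HasTypeIDecay C u) (hC : 0 < C) :
    ∃ (V : ℝ → (EuclideanSpace ℝ (Fin 3)) → (EuclideanSpace ℝ (Fin 3))) (Q : ℝ → (EuclideanSpace ℝ (Fin 3)) → ℝ),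
      uncurry V =ᵐ[volume.restrict (Iio (0 : ℝ) ×ˢ (univ : Set (EuclideanSpace ℝ (Fin 3))))] uncurry u ∧
      IsSuitableWeakSolutionOn (slab (EuclideanSpace ℝ (Fin 3)) (Iio (0 : ℝ)) isOpen_Iio) 1 0 V Q ∧
      HasWeakSpatialGradientOn (slab (EuclideanSpace ℝ (Fin 3)) (Iio (0 : ℝ)) isOpen_Iio) V (fun t x => fderiv ℝ (V t) x) ∧
      typeIBound (Iio (0 : ℝ) ×ˢ univ) V Q (fun t x => fderiv ℝ (V t) x) < ⊤ ∧
      HasTypeIDecay C V := by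
  obtain ⟨V, hae, hV, hdV⟩ := exists_typeIAncientMild_repr_of_hasTypeIDecay hsw hd
  obtain ⟨Q, hswV, hwgV, hIV⟩ := exists_pressure_typeIBound_lt_top hC hV hdV
  exact ⟨V, Q, hae, hswV, hwgV, hIV, hdV⟩

/-! ### The item without bookkeeping -/

/-- **`NoApexTypeIProfile` is KNSS (1.6) verbatim: the Albritton–Barker hypothesis `𝐈 < ∞` and the
weak gradient are idle.**  Item stmt-NavierStokesRegularity-11716 is EQUIVALENT to: no suitable weak
solution `(u, p)` of Navier–Stokes (`ν = 1`, `f = 0`) on `ℝ³ × (−∞,0)` with the space–time Type-I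
bound `‖u(t,x)‖ ≤ C/(‖x‖+√(−t))` has a backward-singular space–time origin.  (`→`: a singular apex
profile has `0 < C`, and its Type-I ancient mild representative with its Riesz pressure is a singular
apex profile of the full class — singularity is invariant under a.e. modification; `←`: drop the
hypotheses.) [cite: KNSS2009, (1.6)] [cite: AlbrittonBarker2019, §1] -/
theorem noApexTypeIProfile_iff_knss :
    SqueezeCycle.NoApexTypeIProfile ↔
      ∀ (u : ℝ → (EuclideanSpace ℝ (Fin 3)) → (EuclideanSpace ℝ (Fin 3))) (p : ℝ → (EuclideanSpace ℝ (Fin 3)) → ℝ) (C : ℝ), IsSuitableWeakSolutionOn (slab (EuclideanSpace ℝ (Fin 3)) (Iio (0 : ℝ)) isOpen_Iio) 1 0 u p →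
        HasTypeIDecay C u → ¬ IsBackwardSingularPoint u 0 := by
  constructor
  · intro hX u p C hsw hd hsing
    have hC : 0 < C := pos_const_of_apexSingular hd hsing
    obtain ⟨V, Q, hae, hswV, hwgV, hIV, hdV⟩ := exists_apexProfile_repr hsw hd hC
    have hsingV : IsBackwardSingularPoint V 0 :=
      hsing.congr_ae (fun r _ => parabolicCylinder_origin_subset_slab r) hae.symm
    exact hX V Q _ C hswV hwgV hIV hdV hsingV
  · intro h u p G C hsw _ _ hd
    exact h u p C hsw hd

/-- The two route copies of the item agree by name (SqueezeCycle rank-2 crux = RellichScar target).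
[cite: KNSS2009, (1.6)] -/
theorem noApexTypeIProfile_iff_rellichScar :
    SqueezeCycle.NoApexTypeIProfile ↔ RellichScar.NoApexTypeIProfile := Iff.rfl

/-- **KNSS (1.6) form of RellichScar's target**, by name. [cite: KNSS2009, (1.6)] -/
theorem rellichScar_noApexTypeIProfile_iff_knss :
    RellichScar.NoApexTypeIProfile ↔
      ∀ (u : ℝ → (EuclideanSpace ℝ (Fin 3)) → (EuclideanSpace ℝ (Fin 3))) (p : ℝ → (EuclideanSpace ℝ (Fin 3)) → ℝ) (C : ℝ), IsSuitableWeakSolutionOn (slab (EuclideanSpace ℝ (Fin 3)) (Iio (0 : ℝ)) isOpen_Iio) 1 0 u p →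
        HasTypeIDecay C u → ¬ IsBackwardSingularPoint u 0 :=
  noApexTypeIProfile_iff_rellichScar.symm.trans noApexTypeIProfile_iff_knss

end Summit.NavierStokesRegularity.NavierStokesRegularity.Theorems.NoApexKNSS

end
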